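import Summits.Ventures.PercRepro.RankLevelSetCrossStep

/-!
# PercRepro — C-025: the LEVEL-WISE single-element step with the cross term (night-1, gen 0)

The level-wise form (R1) of C-025 (typer-2's `Levelwise`: `C(p+q,u)·#U(p,q) ≤ C(p+q,p)·W_u` at every level `u`) is the
statement the cell regards as the one to prove (mine-2 §10 Lemma J). This file gives its single-element induction step
with the cross term, on top of `RankLevelSetCrossStep`:

* **`levelCount_delete_contract_identity`** — `W_{u+1}(M) = W_{u+1}(M∖e) + W_u(M/e)` for a non-loop `e` (exact; the
  level-wise twin of (6.1): a set avoiding `e` keeps its rank, `insert e S'` has rank `r_{M/e}(S') + 1`);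
* **`levelwise_step_of_delete_contract_cross`** — at the level `u+1` of the pair `(p+1, q+1)`, with
  `c = C(p+q+2, u+1)/C(p+q+2, p+1)` and `c' = C(p+q, u)/C(p+q, p)`: from the level-wise bodies for `M ＼ {e}` at
  `(p+1, q+1)`, level `u+1`, and for `M ／ {e}` at `(p, q)`, level `u`, plus the signed cross condition
  `c·(n⁰⁰_{p+1,q} + n⁰⁰_{p,q+1}) ≤ c·(n⁰⁰_{p+1,q+1} + n⁰⁰_{p,q}) + (c' − c)·#U_{M/e}(p,q)`, the level-wise body for `M`.
  (Lemma E level-wise: `c ≤ c'` on `q ≤ u ≤ p`, so the condition is implied by `D_e ≤ 0`.)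
Axioms: standard.
-/

open scoped Matroid

namespace PercRepro

namespace Matroid

open Set

variable {α : Type} {M : _root_.Matroid α} {e : α} [M.Finite]

/-- **`W_{u+1}(M) = W_{u+1}(M ＼ e) + W_u(M ／ e)`** for a non-loop `e`. -/
theorem levelCount_delete_contract_identity (he : M.Indep {e}) (u : ℕ) :
    levelCount M (u + 1) = levelCount (M ＼ {e}) (u + 1) + levelCount (M ／ {e}) u := by
  have heE : e ∈ M.E := he.subset_ground (mem_singleton e)
  unfold levelCount
  set W := {S : Set α | S ⊆ M.E ∧ M.eRk S = ((u + 1 : ℕ) : ℕ∞)} with hW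
  have hWfin : W.Finite := M.ground_finite.finite_subsets.subset (fun _ hA => hA.1)
  rw [ncard_split hWfin (fun A => e ∈ A)]
  have hout : {A | A ∈ W ∧ ¬ e ∈ A} =
      {S : Set α | S ⊆ (M ＼ {e}).E ∧ (M ＼ {e}).eRk S = ((u + 1 : ℕ) : ℕ∞)} := by
    ext A
    simp only [hW, mem_setOf_eq, _root_.Matroid.delete_ground]
    constructor
    · rintro ⟨⟨hA, h1⟩, heA⟩
      have hA' : A ⊆ M.E \ {e} := fun x hx => ⟨hA hx, fun hxe => heA (hxe ▸ hx)⟩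
      rw [delete_singleton_eRk_eq hA']
      exact ⟨hA', h1⟩
    · rintro ⟨hA', h1⟩
      rw [delete_singleton_eRk_eq hA'] at h1
      exact ⟨⟨hA'.trans sdiff_subset, h1⟩, fun h => (hA' h).2 rfl⟩
  have hin : {A | A ∈ W ∧ e ∈ A} = (fun A => insert e A) ''
      {S : Set α | S ⊆ (M ／ {e}).E ∧ (M ／ {e}).eRk S = (u : ℕ∞)} := by
    ext A
    simp only [hW, mem_setOf_eq, mem_image, _root_.Matroid.contract_ground]
    constructor
    · rintro ⟨⟨hA, h1⟩, heA⟩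
      refine ⟨A \ {e}, ⟨sdiff_subset_sdiff_left hA, ?_⟩,
        by rw [insert_sdiff_singleton, insert_eq_of_mem heA]⟩
      have hr := contract_singleton_eRk_add_one he (sdiff_subset_sdiff_left hA : A \ {e} ⊆ M.E \ {e})
      rw [insert_sdiff_singleton, insert_eq_of_mem heA, h1] at hr
      exact eq_coe_of_add_one_eq hr
    · rintro ⟨A', ⟨hA', h1⟩, rfl⟩
      have hr := contract_singleton_eRk_add_one he hA'
      refine ⟨⟨insert_subset heE (hA'.trans sdiff_subset), ?_⟩, mem_insert e A'⟩
      rw [← hr, h1]; push_cast; rfl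
  rw [hout, hin, InjOn.ncard_image, add_comm]
  intro A hA A' hA' hEq
  have h1 : e ∉ A := fun h => (hA.1 h).2 rfl
  have h2 : e ∉ A' := fun h => (hA'.1 h).2 rfl
  simp only at hEq
  rw [← insert_sdiff_self_of_notMem h1, ← insert_sdiff_self_of_notMem h2, hEq]

/-- **The level-wise single-element step with the cross term**: at level `u + 1` of `(p+1, q+1)`, with
`c = C(p+q+2, u+1)/C(p+q+2, p+1)` and `c' = C(p+q, u)/C(p+q, p)`, the level-wise body for `M` follows from the
bodies for `M ＼ {e}` (level `u+1`, pair `(p+1, q+1)`) and `M ／ {e}` (level `u`, pair `(p, q)`) and the signed cross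
condition `c·(n⁰⁰_{p+1,q} + n⁰⁰_{p,q+1}) ≤ c·(n⁰⁰_{p+1,q+1} + n⁰⁰_{p,q}) + (c' − c)·#U_{M/e}(p, q)`. -/
theorem levelwise_step_of_delete_contract_cross (he : M.Indep {e}) (p q u : ℕ)
    (h1 : ((p + q + 2).choose (u + 1) : ℚ) / ((p + q + 2).choose (p + 1) : ℚ) *
        (topCount (M ＼ {e}) (p + 1) (q + 1) : ℚ) ≤ (levelCount (M ＼ {e}) (u + 1) : ℚ))
    (h2 : ((p + q).choose u : ℚ) / ((p + q).choose p : ℚ) * (topCount (M ／ {e}) p q : ℚ) ≤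
        (levelCount (M ／ {e}) u : ℚ))
    (hcross : ((p + q + 2).choose (u + 1) : ℚ) / ((p + q + 2).choose (p + 1) : ℚ) *
        ((freeCount M e (p + 1) q : ℚ) + freeCount M e p (q + 1)) ≤
      ((p + q + 2).choose (u + 1) : ℚ) / ((p + q + 2).choose (p + 1) : ℚ) *
        ((freeCount M e (p + 1) (q + 1) : ℚ) + freeCount M e p q) +
      (((p + q).choose u : ℚ) / ((p + q).choose p : ℚ) -
        ((p + q + 2).choose (u + 1) : ℚ) / ((p + q + 2).choose (p + 1) : ℚ)) * (topCount (M ／ {e}) p q : ℚ)) :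
    ((p + q + 2).choose (u + 1) : ℚ) / ((p + q + 2).choose (p + 1) : ℚ) * (topCount M (p + 1) (q + 1) : ℚ) ≤
      (levelCount M (u + 1) : ℚ) :=
  step_arith_cross (topCount_delete_contract_identity he p q) (levelCount_delete_contract_identity he u)
    h1 h2 hcross

end Matroid

end PercRepro
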